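import Summits.BirchSwinnertonDyer.BirchSwinnertonDyer.Theorems.ThetaPartnerAtTwoSignedKatoUpToAtTwoOfPubLayerSide
import Summits.BirchSwinnertonDyer.BirchSwinnertonDyer.Theorems.ThetaPartnerAtTwoSignedKatoUpToAtTwoLayerSideNoPTOfCore
import Summits.BirchSwinnertonDyer.BirchSwinnertonDyer.Theorems.ThetaPartnerAtTwoSignedKatoUpToAtTwoLayerKummerWitness
import HarnessLib

/-!
# Route `ThetaPartnerAtTwo` (TP2), crux K3 `SignedKatoDivisibilityUpToAtTwo` (item stmt-BirchSwinnertonDyer-20308),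
# line `colemanrat` v8 — THE CERTIFICATE «K3 BY NAME ⟸ {Kato Thm. 13.4 (2) at 2 print-exact, GZK, (S2) Poitou–Tate at a finite
# layer, CORE}» and the v8 glue (R2c) ⟸ (S2) ∧ (S3′), Theorems-side

Width seat `bsd-wall-tp2-p2x-w3` g5 (cell `bsd-wall`). HONEST FRAMING: theorems only — three elementary `ℤ_[p]`/projection lemmas,
the glue and two compositions of landed theorems (no definition, no named fact, no instance, no `sorry`). Every theorem here is
CONDITIONAL on its displayed hypotheses; nothing closes an item; K3 is NOT settled and BSD is NOT proved by any of this.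

## What is here

* §1 the v8 GLUE of the registered skeleton `Cruxes/SignedKatoDivisibilityUpToAtTwo/Lines/colemanrat.lean` (lead `bsd-wall-tp2-p2x` g5,
  sha16 7465880b40c5a36d), re-landed Theorems-side so that the certificate chain is by name: `OfPubCore.layerSideTwoInv_of_ptOrth_of_noPT :
  (S2) → (S3′) → (R2c)` — (S2) = `stub_ptOrthLayerTwo` (Poitou–Tate orthogonality `2 • ⟨red x, 2^{L₀}Q'⟩_{N,2^{L₀}} = 0` at a finite
  layer/level for the (D-layer) pairings `LayerPairing.layerPairingPk`), (S3′) = `stub_layerSideNoPTTwo`, (R2c) = v7's `stub_layerSideTwoInv`,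
  all three VERBATIM; proof = the lead's (descend the Kummer witness to a layer `N ≥ n` by G1
  `LayerWitness.exists_signedSelmerLayer_kummerWitness_two`, apply (S2) at level `k + K₀ + j`, read through (P3), descend the level,
  return to layer `n` by (P1) along the pin), with its three helper lemmas.
* §2 THE CERTIFICATE `OfPubCore.signedKatoDivisibilityUpToAtTwo_of_contraFact_of_gzk_of_ptOrth_of_core`: K3 BY NAME from the two published facts
  `Kato2004.thm13_4_two_lengthAt_fineSelmerDualContra_le_of_isEulerSystemClassTwo` (Kato Thm. 13.4 (2) at `p = 2`, contragredient fine dual,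
  print-exact; unproved in the tree) and `rank_eq_analyticRank_of_analyticRank_le_one` (Gross–Zagier–Kolyvagin; unproved in the tree), the
  KERNEL stub (S2) and CORE = the published core of (S3′) stated ON THE `T₂E`-adic local Tate pairing (Honda-choice + Kato's zeta element
  Thm. 12.5 + the explicit reciprocity law at `2` in ♭-Coleman currency, Kobayashi Thm. 6.3 / Otsuki 2009; spelled in
  `…LayerSideNoPTOfCore.lean`).  Composition: `signedKatoDivisibilityUpToAtTwo_of_contraFact_of_gzk_of_layerSide` (lead g4) ∘ §1 ∘ `NoPTOfCore.layerSideNoPTTwo_of_core`.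

So on line `colemanrat` v8 the crux K3 reads BY NAME: K3 ⟸ {13.4(2)@2, GZK} ∪ {(S2) kernel, CORE print}.  What this does NOT do: (S2)
(the lead's / w2's closer), CORE (PUB), the two named facts; hence not K3, not BSD.

References: [Kato2004Asterisque] Thm. 12.5, 13.4 (2), §17.13; [Kobayashi2003] Thm. 6.3, (7.16)–(7.21), Thm. 7.3, (8.23); [GrossZagier1986];
[Kolyvagin1990]; [MilneADT2006] I.4.10.
-/

set_option autoImplicit false
-- the Theorems namespace of this sub repeats the summit name by design (D-0017 nested layout)
set_option linter.dupNamespace false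

noncomputable section

open scoped Classical MatrixGroups ModularForm NumberField

open CongruenceSubgroup WeierstrassCurve Field IsDedekindDomain NumberField
  Literature.NumberTheory.GaloisRepresentations
  Literature.NumberTheory.EllipticCurves Literature.NumberTheory.EllipticCurves.ModularForms
  Literature.NumberTheory.EllipticCurves.Module Literature.NumberTheory.EllipticCurves.Rank1Residual
  Literature.NumberTheory.EllipticCurves.Kobayashi2003 Literature.NumberTheory.EllipticCurves.Kato2004
  Literature.NumberTheory.EllipticCurves.Kato2004.EulerSystemValues Literature.NumberTheory.EllipticCurves.GreenbergSelmer
  Literature.NumberTheory.EllipticCurves.Sprung2012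
  ZpExtension Summit.BirchSwinnertonDyer.Rank1Residual.Supersingular

namespace Summit.BirchSwinnertonDyer.BirchSwinnertonDyer.Theorems.SignedKatoOffTwo.OfPubCore

/-! ## §1 The v8 glue (R2c) ⟸ (S2) ∧ (S3′) (lead `bsd-wall-tp2-p2x` g5, skeleton `colemanrat` v8 — re-landed verbatim) -/

/-- If `p^L ∣ p^e · z` in `ℤ_[p]` with `e ≤ L`, then `p^(L-e) ∣ z`. [folklore] -/
theorem pow_sub_dvd_of_pow_dvd_pow_mul {p : ℕ} [hp : Fact p.Prime] {L e : ℕ} (he : e ≤ L) {z : ℤ_[p]}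
    (h : (p : ℤ_[p]) ^ L ∣ (p : ℤ_[p]) ^ e * z) : (p : ℤ_[p]) ^ (L - e) ∣ z := by
  obtain ⟨d, rfl⟩ := Nat.exists_eq_add_of_le he
  rw [Nat.add_sub_cancel_left, pow_add] at *
  have hp0 : (p : ℤ_[p]) ^ e ≠ 0 := pow_ne_zero _ (by exact_mod_cast hp.out.ne_zero)
  exact (mul_dvd_mul_iff_left hp0).mp h

/-- Level descent of a vanishing residue in `ℤ_[p]`: if `(c * p^e * y) mod p^L = 0` and `e + k ≤ L` then `(c * y) mod p^k = 0`
(`ker (mod p^n) = (p^n)`, cancellation of `p^e`). [folklore] -/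
theorem toZModPow_mul_eq_zero_of_level {p : ℕ} [hp : Fact p.Prime] {L e k : ℕ} (hk : e + k ≤ L) (c y : ℤ_[p])
    (h : PadicInt.toZModPow L (c * (p : ℤ_[p]) ^ e * y) = 0) : PadicInt.toZModPow k (c * y) = 0 := by
  have hker : c * (p : ℤ_[p]) ^ e * y ∈ RingHom.ker (PadicInt.toZModPow L) := h
  rw [PadicInt.ker_toZModPow, Ideal.mem_span_singleton] at hker
  have h1 : (p : ℤ_[p]) ^ (L - e) ∣ c * y := by
    refine pow_sub_dvd_of_pow_dvd_pow_mul (by omega) ?_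
    rwa [← mul_assoc, mul_comm ((p : ℤ_[p]) ^ e) c]
  have h2 : (p : ℤ_[p]) ^ k ∣ c * y := (pow_dvd_pow _ (by omega)).trans h1
  change c * y ∈ RingHom.ker (PadicInt.toZModPow k)
  rw [PadicInt.ker_toZModPow, Ideal.mem_span_singleton]
  exact h2

/-- (P1) iterated along the pin: `pair n (proj n x) P = pair (n + e) (proj (n + e) x) P` for `P ∈ E(ℚ_{n,v})`. [cite: Kobayashi2003, (8.23) (p. 18)] -/
theorem pair_proj_eq_pair_proj_add {v : HeightOneSpectrum (𝓞 ℚ)} {W : WeierstrassCurve ℚ} [W.IsElliptic]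
    [ContinuousSMul ℤ_[2] (W.tateModule 2)] {κ : ZpExtension ℚ 2}
    {γ : absoluteGaloisGroup ℚ} (I : Kato2004.IwasawaH1Data W 2 κ γ)
    (pair : ∀ n : ℕ, H1 (tateRep W 2) (κ.layerSubgroup n) →ₗ[ℤ_[2]]
      (localLayerPointsOfEmb κ (closureEmb (K := ℚ) (v.adicCompletion ℚ)) W n →+ ℤ_[2]))
    (hP1 : ∀ (n : ℕ) (x : H1 (tateRep W 2) (κ.layerSubgroup (n + 1))) (Q : localPoints W (v.adicCompletion ℚ))
      (hQ : Q ∈ localLayerPointsOfEmb κ (closureEmb (K := ℚ) (v.adicCompletion ℚ)) W n),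
      pair n (layerCores (tateRep W 2) κ n x) ⟨Q, hQ⟩ =
        pair (n + 1) x ⟨Q, localLayerPointsOfEmb_mono κ (closureEmb (K := ℚ) (v.adicCompletion ℚ)) W (Nat.le_succ n) hQ⟩)
    (x : I.H) (n e : ℕ) (P : localPoints W (v.adicCompletion ℚ))
    (hP : P ∈ localLayerPointsOfEmb κ (closureEmb (K := ℚ) (v.adicCompletion ℚ)) W n) :
    pair n (I.proj n x) ⟨P, hP⟩ =
      pair (n + e) (I.proj (n + e) x) ⟨P, localLayerPointsOfEmb_mono κ _ W (Nat.le_add_right n e) hP⟩ := by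
  induction e with
  | zero => rfl
  | succ e ih =>
    rw [ih, ← I.cores_proj (n + e) x]
    exact hP1 (n + e) (I.proj (n + e + 1) x) P _

/-- **(R2c) ⟸ (S2) ∧ (S3′)** — the v8 glue of skeleton `colemanrat` (lead g5), Theorems-side: hypotheses (S2) = `stub_ptOrthLayerTwo`
and (S3′) = `stub_layerSideNoPTTwo` VERBATIM; conclusion (R2c) = v7's `stub_layerSideTwoInv` VERBATIM (`m := 1`). (PT-orth) at
`(n, x, t, φ, Q, k)`: descend the Kummer witness to a layer `N ≥ n` (`LayerWitness.exists_signedSelmerLayer_kummerWitness_two`,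
GoodSS at `2`), apply (S2) at level `L₀ = k + K₀ + j` (`2^{K₀} φ_N = 0`, `2^j R = 0`), read through (P3), descend the level
(`toZModPow_mul_eq_zero_of_level`), and move back to layer `n` by (P1) along the pin. [cite: Kobayashi2003, (7.16)–(7.21), (8.23)]
[cite: Kato2004Asterisque, §17.13 (p. 279)] -/
theorem layerSideTwoInv_of_ptOrth_of_noPT
    (hS2 :
      ∀ (v : HeightOneSpectrum (𝓞 ℚ)), ((2 : ℕ) : 𝓞 ℚ) ∈ v.asIdeal →
      ∀ (W : WeierstrassCurve ℚ) [W.IsElliptic] [ContinuousSMul ℤ_[2] (W.tateModule 2)]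
        (κ : ZpExtension ℚ 2), κ.IsCyclotomic →
      ∀ (ePk : ∀ k : ℕ, geomTorsion W (2 ^ k) → geomTorsion W (2 ^ k) → AlgebraicClosure ℚ)
        (hμ : ∀ k S T, ePk k S T ^ (2 ^ k) = 1)
        (hadd₁ : ∀ k S₁ S₂ T, ePk k (S₁ + S₂) T = ePk k S₁ T * ePk k S₂ T)
        (hadd₂ : ∀ k S T₁ T₂, ePk k S (T₁ + T₂) = ePk k S T₁ * ePk k S T₂)
        (hgal : ∀ k (σ : absoluteGaloisGroup ℚ) (S T : geomTorsion W (2 ^ k)), σ • ePk k S T = ePk k (σ • S) (σ • T)),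
        (∀ (k : ℕ) (S' : geomTorsion W (2 ^ (k + 1))) (S : geomTorsion W (2 ^ k)) (T' : geomTorsion W (2 ^ (k + 1)))
            (T : geomTorsion W (2 ^ k)), (S : W.geomPoints) = (2 : ℤ) • (S' : W.geomPoints) →
            (T' : W.geomPoints) = (T : W.geomPoints) → ePk (k + 1) S' T' = ePk k S T) →
      ∀ (N L₀ : ℕ) (x : H1 (tateRep W 2) (κ.layerSubgroup N))
        (t : W.subgroupH1 2 (κ.layerSubgroup N)), t ∈ W.selmerLayer κ N →
      ∀ (φN : contOneCocycles (discreteTopRep (κ.layerSubgroup N) (W.geomPrimaryTorsion 2))), oneCocycleClass _ φN = t →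
        (∀ y, (2 ^ L₀ : ℕ) • ((φN.1 y : W.geomPrimaryTorsion 2) : W.geomPoints) = 0) →
      ∀ (Q' : localPoints W (v.adicCompletion ℚ))
        (hP' : (2 ^ L₀ : ℕ) • Q' ∈ localLayerPointsOfEmb κ (closureEmb (K := ℚ) (v.adicCompletion ℚ)) W N),
        (∀ τ : localSubgroupOfEmb (κ.layerSubgroup N) (closureEmb (K := ℚ) (v.adicCompletion ℚ)),
          pointsMapOfEmb W (closureEmb (K := ℚ) (v.adicCompletion ℚ))
              ((φN.1 (resGalSubgroupOfEmb (κ.layerSubgroup N) _ τ) : W.geomPrimaryTorsion 2) : W.geomPoints) =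
            (τ : absoluteGaloisGroup (v.adicCompletion ℚ)) • Q' - Q') →
        2 • LayerPairing.layerPairingPk W κ v ePk hμ hadd₁ hadd₂ hgal N L₀ x ⟨(2 ^ L₀ : ℕ) • Q', hP'⟩ = 0)
    (hS3 :
      ∀ (v : HeightOneSpectrum (𝓞 ℚ)), ((2 : ℕ) : 𝓞 ℚ) ∈ v.asIdeal →
      ∀ (W : WeierstrassCurve ℚ) [W.IsElliptic] [W.IsGloballyMinimal],
        ¬ W.HasCM → W.analyticRank = 0 → GoodSS W 2 → W.frobeniusTrace 2 = 0 →
        ∀ (κ : ZpExtension ℚ 2) (γ : Field.absoluteGaloisGroup ℚ) (hκ : κ.IsCyclotomic),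
          κ.IsTopGenerator γ → IsCyclotomicVariable 2 γ →
          ∀ [NeZero (W.conductorNorm ℤ)] (f : CuspForm (Gamma0 (W.conductorNorm ℤ)) 2),
            IsNewformOf W f → ∀ (ϖ : ℚ), (ϖ : ℝ) * W.realPeriodRat = plusPeriod f →
          ∀ (Lplus Lminus : IwasawaAlgebra 2), IsPollackPair f 2 Lplus Lminus →
          ∀ [ContinuousSMul ℤ_[2] (W.tateModule 2)] [Module.Free ℤ_[2] (W.tateModule 2)]
            [Module.Finite ℤ_[2] (W.tateModule 2)],
          ∀ 𝔭 : PrimeSpectrum (IwasawaAlgebra 2), 𝔭.asIdeal.height = 1 →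
            PowerSeries.C (2 : ℤ_[2]) ∉ 𝔭.asIdeal →
          ∃ (g : absoluteGaloisGroup (v.adicCompletion ℚ))
            (_ : κ.IsTopGenerator (resGalOfEmb (closureEmb (K := ℚ) (v.adicCompletion ℚ)) g))
            (d : ℕ → localPoints W (v.adicCompletion ℚ))
            (I : Kato2004.IwasawaH1Data W 2 κ γ)
            (pair : ∀ n : ℕ, H1 (tateRep W 2) (κ.layerSubgroup n) →ₗ[ℤ_[2]]
              (localLayerPointsOfEmb κ (closureEmb (K := ℚ) (v.adicCompletion ℚ)) W n →+ ℤ_[2]))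
            (s : I.H)
            (ePk : ∀ k : ℕ, geomTorsion W (2 ^ k) → geomTorsion W (2 ^ k) → AlgebraicClosure ℚ)
            (hμ : ∀ k S T, ePk k S T ^ (2 ^ k) = 1)
            (hadd₁ : ∀ k S₁ S₂ T, ePk k (S₁ + S₂) T = ePk k S₁ T * ePk k S₂ T)
            (hadd₂ : ∀ k S T₁ T₂, ePk k S (T₁ + T₂) = ePk k S T₁ * ePk k S T₂)
            (hgal : ∀ k (σ : absoluteGaloisGroup ℚ) (S T : geomTorsion W (2 ^ k)), σ • ePk k S T = ePk k (σ • S) (σ • T)),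
            (∀ n, d n ∈ localLayerPointsOfEmb κ (closureEmb (K := ℚ) (v.adicCompletion ℚ)) W n) ∧
            (∀ n, localTraceOfEmb κ (closureEmb (K := ℚ) (v.adicCompletion ℚ)) W (n + 1) (n + 2) (d (n + 2)) = -d n) ∧
            (∀ n : ℕ, 1 ≤ n → ∀ P ∈ localLayerPointsOfEmb κ (closureEmb (K := ℚ) (v.adicCompletion ℚ)) W n,
              ∃ B ∈ AddSubgroup.closure (Set.range fun σ : absoluteGaloisGroup (v.adicCompletion ℚ) ↦ σ • d n),
                ∃ P' ∈ localLayerPointsOfEmb κ (closureEmb (K := ℚ) (v.adicCompletion ℚ)) W (n - 1),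
                ∃ R ∈ localLayerPointsOfEmb κ (closureEmb (K := ℚ) (v.adicCompletion ℚ)) W n, P = B + P' + 2 • R) ∧
            (∀ P ∈ localLayerPointsOfEmb κ (closureEmb (K := ℚ) (v.adicCompletion ℚ)) W 0,
              ∃ a : ℤ, ∃ R ∈ localLayerPointsOfEmb κ (closureEmb (K := ℚ) (v.adicCompletion ℚ)) W 0, P = a • d 0 + 2 • R) ∧
            (∀ (n : ℕ) (x : H1 (tateRep W 2) (κ.layerSubgroup (n + 1))) (Q : localPoints W (v.adicCompletion ℚ))
              (hQ : Q ∈ localLayerPointsOfEmb κ (closureEmb (K := ℚ) (v.adicCompletion ℚ)) W n),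
              pair n (layerCores (tateRep W 2) κ n x) ⟨Q, hQ⟩ =
                pair (n + 1) x ⟨Q, localLayerPointsOfEmb_mono κ (closureEmb (K := ℚ) (v.adicCompletion ℚ)) W (Nat.le_succ n) hQ⟩) ∧
            (∀ (n : ℕ) (y : H1 (tateRep W 2) (κ.layerSubgroup n)) (Q : localPoints W (v.adicCompletion ℚ))
              (hQ : Q ∈ localLayerPointsOfEmb κ (closureEmb (K := ℚ) (v.adicCompletion ℚ)) W n),
              pair n (conjMap (tateRep W 2).toTopRep (κ.layerSubgroup n) (resGalOfEmb (closureEmb (K := ℚ) (v.adicCompletion ℚ)) g) 1 y)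
                ⟨g • Q, smul_mem_localLayerPointsOfEmb κ (closureEmb (K := ℚ) (v.adicCompletion ℚ)) W n g hQ⟩ = pair n y ⟨Q, hQ⟩) ∧
            -- (WEIL) one-step level compatibility of the family `e_k`
            (∀ (k : ℕ) (S' : geomTorsion W (2 ^ (k + 1))) (S : geomTorsion W (2 ^ k)) (T' : geomTorsion W (2 ^ (k + 1)))
              (T : geomTorsion W (2 ^ k)), (S : W.geomPoints) = (2 : ℤ) • (S' : W.geomPoints) →
              (T' : W.geomPoints) = (T : W.geomPoints) → ePk (k + 1) S' T' = ePk k S T) ∧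
            -- (P3) the residue clause: `pair` is THE local Tate pairing of the (D-layer) construction
            (∀ (n k : ℕ) (x : H1 (tateRep W 2) (κ.layerSubgroup n))
              (Q : localLayerPointsOfEmb κ (closureEmb (K := ℚ) (v.adicCompletion ℚ)) W n),
              PadicInt.toZModPow k (pair n x Q) = LayerPairing.layerPairingPk W κ v ePk hμ hadd₁ hadd₂ hgal n k x Q) ∧
            Kato2004.IsEulerSystemClassTwo W hκ I s ∧
            (∀ col₀ : I.H →+ (localTowerPointsOfEmb κ (closureEmb (K := ℚ) (v.adicCompletion ℚ)) W →+ ℤ_[2]),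
              (∀ (n : ℕ) (x : I.H) (Q : localPoints W (v.adicCompletion ℚ)) (hQ : Q ∈ localLayerPointsOfEmb κ (closureEmb (K := ℚ) (v.adicCompletion ℚ)) W n),
                col₀ x ⟨Q, localLayerPointsOfEmb_le_localTowerPointsOfEmb κ (closureEmb (K := ℚ) (v.adicCompletion ℚ)) W n hQ⟩ = pair n (I.proj n x) ⟨Q, hQ⟩) →
              ∀ Ls Lf : IwasawaAlgebra 2, IsColemanPair κ (closureEmb (K := ℚ) (v.adicCompletion ℚ)) W 0 g d (col₀ s) Ls Lf →
                lengthAt (IwasawaAlgebra 2) (IwasawaAlgebra 2 ⧸ Ideal.span {Lf}) 𝔭 ≤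
                  lengthAt (IwasawaAlgebra 2) (IwasawaAlgebra 2 ⧸ Ideal.span {kobayashiL 1 Lplus Lminus}) 𝔭)) :
    ∀ (v : HeightOneSpectrum (𝓞 ℚ)), ((2 : ℕ) : 𝓞 ℚ) ∈ v.asIdeal →
    ∀ (W : WeierstrassCurve ℚ) [W.IsElliptic] [W.IsGloballyMinimal],
      ¬ W.HasCM → W.analyticRank = 0 → GoodSS W 2 → W.frobeniusTrace 2 = 0 →
      ∀ (κ : ZpExtension ℚ 2) (γ : Field.absoluteGaloisGroup ℚ) (hκ : κ.IsCyclotomic),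
        κ.IsTopGenerator γ → IsCyclotomicVariable 2 γ →
        ∀ [NeZero (W.conductorNorm ℤ)] (f : CuspForm (Gamma0 (W.conductorNorm ℤ)) 2),
          IsNewformOf W f → ∀ (ϖ : ℚ), (ϖ : ℝ) * W.realPeriodRat = plusPeriod f →
        ∀ (Lplus Lminus : IwasawaAlgebra 2), IsPollackPair f 2 Lplus Lminus →
        ∀ [ContinuousSMul ℤ_[2] (W.tateModule 2)] [Module.Free ℤ_[2] (W.tateModule 2)]
          [Module.Finite ℤ_[2] (W.tateModule 2)],
        ∀ 𝔭 : PrimeSpectrum (IwasawaAlgebra 2), 𝔭.asIdeal.height = 1 →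
          PowerSeries.C (2 : ℤ_[2]) ∉ 𝔭.asIdeal →
        ∃ (g : absoluteGaloisGroup (v.adicCompletion ℚ))
          (_ : κ.IsTopGenerator (resGalOfEmb (closureEmb (K := ℚ) (v.adicCompletion ℚ)) g))
          (d : ℕ → localPoints W (v.adicCompletion ℚ))
          (I : Kato2004.IwasawaH1Data W 2 κ γ)
          (pair : ∀ n : ℕ, H1 (tateRep W 2) (κ.layerSubgroup n) →ₗ[ℤ_[2]]
            (localLayerPointsOfEmb κ (closureEmb (K := ℚ) (v.adicCompletion ℚ)) W n →+ ℤ_[2]))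
          (s : I.H) (m : ℕ),
          (∀ n, d n ∈ localLayerPointsOfEmb κ (closureEmb (K := ℚ) (v.adicCompletion ℚ)) W n) ∧
          (∀ n, localTraceOfEmb κ (closureEmb (K := ℚ) (v.adicCompletion ℚ)) W (n + 1) (n + 2) (d (n + 2)) = -d n) ∧
          (∀ n : ℕ, 1 ≤ n → ∀ P ∈ localLayerPointsOfEmb κ (closureEmb (K := ℚ) (v.adicCompletion ℚ)) W n,
            ∃ B ∈ AddSubgroup.closure (Set.range fun σ : absoluteGaloisGroup (v.adicCompletion ℚ) ↦ σ • d n),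
              ∃ P' ∈ localLayerPointsOfEmb κ (closureEmb (K := ℚ) (v.adicCompletion ℚ)) W (n - 1),
              ∃ R ∈ localLayerPointsOfEmb κ (closureEmb (K := ℚ) (v.adicCompletion ℚ)) W n, P = B + P' + 2 • R) ∧
          (∀ P ∈ localLayerPointsOfEmb κ (closureEmb (K := ℚ) (v.adicCompletion ℚ)) W 0,
            ∃ a : ℤ, ∃ R ∈ localLayerPointsOfEmb κ (closureEmb (K := ℚ) (v.adicCompletion ℚ)) W 0, P = a • d 0 + 2 • R) ∧
          (∀ (n : ℕ) (x : H1 (tateRep W 2) (κ.layerSubgroup (n + 1))) (Q : localPoints W (v.adicCompletion ℚ))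
            (hQ : Q ∈ localLayerPointsOfEmb κ (closureEmb (K := ℚ) (v.adicCompletion ℚ)) W n),
            pair n (layerCores (tateRep W 2) κ n x) ⟨Q, hQ⟩ =
              pair (n + 1) x ⟨Q, localLayerPointsOfEmb_mono κ (closureEmb (K := ℚ) (v.adicCompletion ℚ)) W (Nat.le_succ n) hQ⟩) ∧
          (∀ (n : ℕ) (y : H1 (tateRep W 2) (κ.layerSubgroup n)) (Q : localPoints W (v.adicCompletion ℚ))
            (hQ : Q ∈ localLayerPointsOfEmb κ (closureEmb (K := ℚ) (v.adicCompletion ℚ)) W n),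
            pair n (conjMap (tateRep W 2).toTopRep (κ.layerSubgroup n) (resGalOfEmb (closureEmb (K := ℚ) (v.adicCompletion ℚ)) g) 1 y)
              ⟨g • Q, smul_mem_localLayerPointsOfEmb κ (closureEmb (K := ℚ) (v.adicCompletion ℚ)) W n g hQ⟩ = pair n y ⟨Q, hQ⟩) ∧
          (∀ (n : ℕ) (x : I.H) (t : W.subgroupH1 2 κ.kerSubgroup), t ∈ signedSelmerInfty W κ 1 →
            ∀ (φ : contOneCocycles (discreteTopRep κ.kerSubgroup (W.geomPrimaryTorsion 2)))
              (Q : localPoints W (v.adicCompletion ℚ)) (k : ℕ), oneCocycleClass _ φ = t →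
            ∀ hQn : 2 ^ k • Q ∈ localLayerPointsOfEmb κ (closureEmb (K := ℚ) (v.adicCompletion ℚ)) W n,
            2 ^ k • Q ∈ (⨆ n, signedLocalPoints κ (v.adicCompletion ℚ) W 1 n) →
            (∀ τ : localSubgroupOfEmb κ.kerSubgroup (closureEmb (K := ℚ) (v.adicCompletion ℚ)),
              pointsMapOfEmb W (closureEmb (K := ℚ) (v.adicCompletion ℚ))
                  ((φ.1 (resGalSubgroupOfEmb κ.kerSubgroup _ τ) : W.geomPrimaryTorsion 2) : W.geomPoints) =
                (τ : absoluteGaloisGroup (v.adicCompletion ℚ)) • Q - Q) →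
            (PadicInt.toZModPow k (2 ^ m * pair n (I.proj n x) ⟨2 ^ k • Q, hQn⟩)).val •
              ((((2 : ℚ) ^ k)⁻¹ : ℚ) : AddCircle (1 : ℚ)) = 0) ∧
          Kato2004.IsEulerSystemClassTwo W hκ I s ∧
          (∀ col₀ : I.H →+ (localTowerPointsOfEmb κ (closureEmb (K := ℚ) (v.adicCompletion ℚ)) W →+ ℤ_[2]),
            (∀ (n : ℕ) (x : I.H) (Q : localPoints W (v.adicCompletion ℚ)) (hQ : Q ∈ localLayerPointsOfEmb κ (closureEmb (K := ℚ) (v.adicCompletion ℚ)) W n),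
              col₀ x ⟨Q, localLayerPointsOfEmb_le_localTowerPointsOfEmb κ (closureEmb (K := ℚ) (v.adicCompletion ℚ)) W n hQ⟩ = pair n (I.proj n x) ⟨Q, hQ⟩) →
            ∀ Ls Lf : IwasawaAlgebra 2, IsColemanPair κ (closureEmb (K := ℚ) (v.adicCompletion ℚ)) W 0 g d (col₀ s) Ls Lf →
              lengthAt (IwasawaAlgebra 2) (IwasawaAlgebra 2 ⧸ Ideal.span {Lf}) 𝔭 ≤
                lengthAt (IwasawaAlgebra 2) (IwasawaAlgebra 2 ⧸ Ideal.span {kobayashiL 1 Lplus Lminus}) 𝔭) := by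
  intro v hv W _ _ hcm hr hss ha κ γ hκ hγ hvar _ f hf ϖ hϖ Lplus Lminus hPol _ _ _ 𝔭 h𝔭 h2
  obtain ⟨g, hg, d, I, pair, s, ePk, hμ, hadd₁, hadd₂, hgal, hL, hTR, hGEN, hGEN0, hP1, hP2, hW, hP3, hES, hERL⟩ :=
    hS3 v hv W hcm hr hss ha κ γ hκ hγ hvar f hf ϖ hϖ Lplus Lminus hPol 𝔭 h𝔭 h2
  refine ⟨g, hg, d, I, pair, s, 1, hL, hTR, hGEN, hGEN0, hP1, hP2, ?_, hES, hERL⟩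
  intro n x t ht φ Q k hφ hQn _ hw
  -- (1) descend the Kummer witness to a layer `N ≥ n`
  have hv' : (2 : 𝓞 ℚ) ∈ v.asIdeal := by exact_mod_cast hv
  obtain ⟨N, hnN, tN, htN, htNt, hall⟩ :=
    LayerWitness.exists_signedSelmerLayer_kummerWitness_two W hss κ 1 hv' ht φ hφ Q n k hQn hw
  obtain ⟨φN, hφN⟩ := oneCocycleClass_surjective _ tN
  obtain ⟨⟨K₀, hK₀⟩, R, hR⟩ := hall φN hφN
  obtain ⟨jR, hjR⟩ := (AddCommGroup.mem_primaryComponent).1 R.2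
  -- (2) the level `L₀` and the point `Q' = Q − ιR` with `2^{L₀} Q' = 2^{L₀-k} (2^k Q)`
  set L₀ : ℕ := k + K₀ + jR with hL₀
  set R' : localPoints W (v.adicCompletion ℚ) := pointsMapOfEmb W (closureEmb (K := ℚ) (v.adicCompletion ℚ)) (R : W.geomPoints)
    with hR'
  have hkill : ∀ y, (2 ^ L₀ : ℕ) • ((φN.1 y : W.geomPrimaryTorsion 2) : W.geomPoints) = 0 := fun y ↦ by
    rw [hL₀, show k + K₀ + jR = K₀ + (k + jR) from by omega, pow_add, mul_nsmul, hK₀, nsmul_zero]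
  have hR0 : (2 ^ L₀ : ℕ) • R' = 0 := by
    rw [hR', ← map_nsmul, hL₀, pow_add, mul_comm, mul_nsmul, hjR, nsmul_zero, map_zero]
  have hP'eq : (2 ^ L₀ : ℕ) • (Q - R') = (2 ^ (K₀ + jR) : ℕ) • ((2 ^ k : ℕ) • Q) := by
    rw [nsmul_sub, hR0, sub_zero, ← mul_nsmul, ← pow_add, hL₀, add_assoc]
  have hPN : (2 ^ k : ℕ) • Q ∈ localLayerPointsOfEmb κ (closureEmb (K := ℚ) (v.adicCompletion ℚ)) W N :=
    localLayerPointsOfEmb_mono κ _ W hnN hQn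
  have hP'mem : (2 ^ L₀ : ℕ) • (Q - R') ∈ localLayerPointsOfEmb κ (closureEmb (K := ℚ) (v.adicCompletion ℚ)) W N := by
    rw [hP'eq]; exact AddSubgroup.nsmul_mem _ hPN _
  -- (3) S2 at `(N, L₀)`
  have hS2 := hS2 v hv W κ hκ ePk hμ hadd₁ hadd₂ hgal hW N L₀ (I.proj N x) tN
    (signedSelmerLayer_le_selmerLayer W κ 1 N htN) φN hφN hkill (Q - R') hP'mem hR
  -- (4) through (P3): `2 • (pair N (proj N x) P' mod 2^{L₀}) = 0`
  rw [← hP3] at hS2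
  have hsub : (⟨(2 ^ L₀ : ℕ) • (Q - R'), hP'mem⟩ :
      localLayerPointsOfEmb κ (closureEmb (K := ℚ) (v.adicCompletion ℚ)) W N) = (2 ^ (K₀ + jR) : ℕ) • ⟨(2 ^ k : ℕ) • Q, hPN⟩ :=
    Subtype.ext hP'eq
  rw [hsub, map_nsmul, two_nsmul, ← two_mul, nsmul_eq_mul] at hS2
  have hS2' : PadicInt.toZModPow L₀ (2 * ((2 : ℕ) : ℤ_[2]) ^ (K₀ + jR) * pair N (I.proj N x) ⟨(2 ^ k : ℕ) • Q, hPN⟩) = 0 := by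
    rw [← Nat.cast_pow, mul_assoc, map_mul, map_ofNat]; exact hS2
  -- (5) level descent `L₀ → k` and (P1) along the pin back to layer `n`
  have hk : PadicInt.toZModPow k (2 * pair N (I.proj N x) ⟨(2 ^ k : ℕ) • Q, hPN⟩) = 0 :=
    toZModPow_mul_eq_zero_of_level (p := 2) (L := L₀) (e := K₀ + jR) (by rw [hL₀]; omega) 2 _ hS2'
  obtain ⟨e, rfl⟩ := Nat.exists_eq_add_of_le hnN
  rw [← pair_proj_eq_pair_proj_add I pair hP1 x n e _ hQn] at hk
  rw [pow_one, hk, ZMod.val_zero, zero_smul]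

/-! ## §2 The certificate K3 ⟸ {Kato 13.4 (2) at 2, GZK, (S2), CORE} -/

/-- **THE CERTIFICATE on line `colemanrat` v8: K3 BY NAME ⟸ {Kato Thm. 13.4 (2) at `2` (print-exact, contragredient fine dual), GZK,
(S2), CORE}.** Hypotheses: (1) the Literature named fact `Kato2004.thm13_4_two_lengthAt_fineSelmerDualContra_le_of_isEulerSystemClassTwo`;
(2) `rank_eq_analyticRank_of_analyticRank_le_one`; (3) the registered KERNEL stub (S2) `stub_ptOrthLayerTwo` VERBATIM (Poitou–Tate at a
finite layer for the (D-layer) pairings); (4) CORE = the published core of (S3′) on THE local Tate pairing (Honda-choice + Kato's zeta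
element + explicit reciprocity at `2` in ♭-Coleman currency). Conclusion: the crux `SignedKatoDivisibilityUpToAtTwo` of route TP2.
Composition: `signedKatoDivisibilityUpToAtTwo_of_contraFact_of_gzk_of_layerSide` ∘ `layerSideTwoInv_of_ptOrth_of_noPT` ∘ `NoPTOfCore.layerSideNoPTTwo_of_core`. CONDITIONAL on
(1)–(4); closes nothing by itself; BSD is not proved by this. [cite: Kato2004Asterisque, Thm. 13.4 (2) (p. 226), Thm. 12.5 (p. 222), §17.13 (p. 279)]
[cite: Kobayashi2003, Thm. 6.3 (p. 11), Thm. 7.3 (pp. 12–13)] [cite: GrossZagier1986, Thm. I.6.3] [cite: Kolyvagin1990, Thm. A] -/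
theorem signedKatoDivisibilityUpToAtTwo_of_contraFact_of_gzk_of_ptOrth_of_core
    (hK2 : Kato2004.thm13_4_two_lengthAt_fineSelmerDualContra_le_of_isEulerSystemClassTwo)
    (hGZK : rank_eq_analyticRank_of_analyticRank_le_one)
    (hS2 :
      ∀ (v : HeightOneSpectrum (𝓞 ℚ)), ((2 : ℕ) : 𝓞 ℚ) ∈ v.asIdeal →
      ∀ (W : WeierstrassCurve ℚ) [W.IsElliptic] [ContinuousSMul ℤ_[2] (W.tateModule 2)]
        (κ : ZpExtension ℚ 2), κ.IsCyclotomic →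
      ∀ (ePk : ∀ k : ℕ, geomTorsion W (2 ^ k) → geomTorsion W (2 ^ k) → AlgebraicClosure ℚ)
        (hμ : ∀ k S T, ePk k S T ^ (2 ^ k) = 1)
        (hadd₁ : ∀ k S₁ S₂ T, ePk k (S₁ + S₂) T = ePk k S₁ T * ePk k S₂ T)
        (hadd₂ : ∀ k S T₁ T₂, ePk k S (T₁ + T₂) = ePk k S T₁ * ePk k S T₂)
        (hgal : ∀ k (σ : absoluteGaloisGroup ℚ) (S T : geomTorsion W (2 ^ k)), σ • ePk k S T = ePk k (σ • S) (σ • T)),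
        (∀ (k : ℕ) (S' : geomTorsion W (2 ^ (k + 1))) (S : geomTorsion W (2 ^ k)) (T' : geomTorsion W (2 ^ (k + 1)))
            (T : geomTorsion W (2 ^ k)), (S : W.geomPoints) = (2 : ℤ) • (S' : W.geomPoints) →
            (T' : W.geomPoints) = (T : W.geomPoints) → ePk (k + 1) S' T' = ePk k S T) →
      ∀ (N L₀ : ℕ) (x : H1 (tateRep W 2) (κ.layerSubgroup N))
        (t : W.subgroupH1 2 (κ.layerSubgroup N)), t ∈ W.selmerLayer κ N →
      ∀ (φN : contOneCocycles (discreteTopRep (κ.layerSubgroup N) (W.geomPrimaryTorsion 2))), oneCocycleClass _ φN = t →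
        (∀ y, (2 ^ L₀ : ℕ) • ((φN.1 y : W.geomPrimaryTorsion 2) : W.geomPoints) = 0) →
      ∀ (Q' : localPoints W (v.adicCompletion ℚ))
        (hP' : (2 ^ L₀ : ℕ) • Q' ∈ localLayerPointsOfEmb κ (closureEmb (K := ℚ) (v.adicCompletion ℚ)) W N),
        (∀ τ : localSubgroupOfEmb (κ.layerSubgroup N) (closureEmb (K := ℚ) (v.adicCompletion ℚ)),
          pointsMapOfEmb W (closureEmb (K := ℚ) (v.adicCompletion ℚ))
              ((φN.1 (resGalSubgroupOfEmb (κ.layerSubgroup N) _ τ) : W.geomPrimaryTorsion 2) : W.geomPoints) =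
            (τ : absoluteGaloisGroup (v.adicCompletion ℚ)) • Q' - Q') →
        2 • LayerPairing.layerPairingPk W κ v ePk hμ hadd₁ hadd₂ hgal N L₀ x ⟨(2 ^ L₀ : ℕ) • Q', hP'⟩ = 0)
    (hcore :
      ∀ (v : HeightOneSpectrum (𝓞 ℚ)), ((2 : ℕ) : 𝓞 ℚ) ∈ v.asIdeal →
      ∀ (W : WeierstrassCurve ℚ) [W.IsElliptic] [W.IsGloballyMinimal],
        ¬ W.HasCM → W.analyticRank = 0 → GoodSS W 2 → W.frobeniusTrace 2 = 0 →
        ∀ (κ : ZpExtension ℚ 2) (γ : Field.absoluteGaloisGroup ℚ) (hκ : κ.IsCyclotomic),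
          κ.IsTopGenerator γ → IsCyclotomicVariable 2 γ →
          ∀ [NeZero (W.conductorNorm ℤ)] (f : CuspForm (Gamma0 (W.conductorNorm ℤ)) 2),
            IsNewformOf W f → ∀ (ϖ : ℚ), (ϖ : ℝ) * W.realPeriodRat = plusPeriod f →
          ∀ (Lplus Lminus : IwasawaAlgebra 2), IsPollackPair f 2 Lplus Lminus →
          ∀ [ContinuousSMul ℤ_[2] (W.tateModule 2)] [Module.Free ℤ_[2] (W.tateModule 2)]
            [Module.Finite ℤ_[2] (W.tateModule 2)],
          ∀ 𝔭 : PrimeSpectrum (IwasawaAlgebra 2), 𝔭.asIdeal.height = 1 →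
            PowerSeries.C (2 : ℤ_[2]) ∉ 𝔭.asIdeal →
          ∀ (I : Kato2004.IwasawaH1Data W 2 κ γ)
            (pair : ∀ n : ℕ, H1 (tateRep W 2) (κ.layerSubgroup n) →ₗ[ℤ_[2]]
              (localLayerPointsOfEmb κ (closureEmb (K := ℚ) (v.adicCompletion ℚ)) W n →+ ℤ_[2])),
            -- (P1) projection formula
            (∀ (n : ℕ) (x : H1 (tateRep W 2) (κ.layerSubgroup (n + 1))) (Q : localPoints W (v.adicCompletion ℚ))
              (hQ : Q ∈ localLayerPointsOfEmb κ (closureEmb (K := ℚ) (v.adicCompletion ℚ)) W n),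
              pair n (layerCores (tateRep W 2) κ n x) ⟨Q, hQ⟩ =
                pair (n + 1) x ⟨Q, localLayerPointsOfEmb_mono κ (closureEmb (K := ℚ) (v.adicCompletion ℚ)) W (Nat.le_succ n) hQ⟩) →
            -- (P2) Galois invariance, for EVERY `g ∈ Γ_v`
            (∀ (n : ℕ) (g : absoluteGaloisGroup (v.adicCompletion ℚ)) (y : H1 (tateRep W 2) (κ.layerSubgroup n))
              (Q : localPoints W (v.adicCompletion ℚ))
              (hQ : Q ∈ localLayerPointsOfEmb κ (closureEmb (K := ℚ) (v.adicCompletion ℚ)) W n),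
              pair n (conjMap (tateRep W 2).toTopRep (κ.layerSubgroup n) (resGalOfEmb (closureEmb (K := ℚ) (v.adicCompletion ℚ)) g) 1 y)
                ⟨g • Q, smul_mem_localLayerPointsOfEmb κ (closureEmb (K := ℚ) (v.adicCompletion ℚ)) W n g hQ⟩ = pair n y ⟨Q, hQ⟩) →
            -- (P3) `pair` IS the `T₂E`-adic local Tate pairing: residues = the (D-layer) pairings for THE Weil pairings of the tree
            (∀ (n k : ℕ) (x : H1 (tateRep W 2) (κ.layerSubgroup n))
              (Q : localLayerPointsOfEmb κ (closureEmb (K := ℚ) (v.adicCompletion ℚ)) W n),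
              PadicInt.toZModPow k (pair n x Q) =
                LayerPairing.layerPairingPk W κ v (LayerPairing.weilTowerPk W) (LayerPairing.weilTowerPk_pow W)
                  (LayerPairing.weilTowerPk_add_left W) (LayerPairing.weilTowerPk_add_right W) (LayerPairing.weilTowerPk_smul W)
                  n k x Q) →
          ∃ (g : absoluteGaloisGroup (v.adicCompletion ℚ))
            (_ : κ.IsTopGenerator (resGalOfEmb (closureEmb (K := ℚ) (v.adicCompletion ℚ)) g))
            (d : ℕ → localPoints W (v.adicCompletion ℚ)) (s : I.H),
            (∀ n, d n ∈ localLayerPointsOfEmb κ (closureEmb (K := ℚ) (v.adicCompletion ℚ)) W n) ∧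
            (∀ n, localTraceOfEmb κ (closureEmb (K := ℚ) (v.adicCompletion ℚ)) W (n + 1) (n + 2) (d (n + 2)) = -d n) ∧
            (∀ n : ℕ, 1 ≤ n → ∀ P ∈ localLayerPointsOfEmb κ (closureEmb (K := ℚ) (v.adicCompletion ℚ)) W n,
              ∃ B ∈ AddSubgroup.closure (Set.range fun σ : absoluteGaloisGroup (v.adicCompletion ℚ) ↦ σ • d n),
                ∃ P' ∈ localLayerPointsOfEmb κ (closureEmb (K := ℚ) (v.adicCompletion ℚ)) W (n - 1),
                ∃ R ∈ localLayerPointsOfEmb κ (closureEmb (K := ℚ) (v.adicCompletion ℚ)) W n, P = B + P' + 2 • R) ∧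
            (∀ P ∈ localLayerPointsOfEmb κ (closureEmb (K := ℚ) (v.adicCompletion ℚ)) W 0,
              ∃ a : ℤ, ∃ R ∈ localLayerPointsOfEmb κ (closureEmb (K := ℚ) (v.adicCompletion ℚ)) W 0, P = a • d 0 + 2 • R) ∧
            Kato2004.IsEulerSystemClassTwo W hκ I s ∧
            (∀ col₀ : I.H →+ (localTowerPointsOfEmb κ (closureEmb (K := ℚ) (v.adicCompletion ℚ)) W →+ ℤ_[2]),
              (∀ (n : ℕ) (x : I.H) (Q : localPoints W (v.adicCompletion ℚ)) (hQ : Q ∈ localLayerPointsOfEmb κ (closureEmb (K := ℚ) (v.adicCompletion ℚ)) W n),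
                col₀ x ⟨Q, localLayerPointsOfEmb_le_localTowerPointsOfEmb κ (closureEmb (K := ℚ) (v.adicCompletion ℚ)) W n hQ⟩ = pair n (I.proj n x) ⟨Q, hQ⟩) →
              ∀ Ls Lf : IwasawaAlgebra 2, IsColemanPair κ (closureEmb (K := ℚ) (v.adicCompletion ℚ)) W 0 g d (col₀ s) Ls Lf →
                lengthAt (IwasawaAlgebra 2) (IwasawaAlgebra 2 ⧸ Ideal.span {Lf}) 𝔭 ≤
                  lengthAt (IwasawaAlgebra 2) (IwasawaAlgebra 2 ⧸ Ideal.span {kobayashiL 1 Lplus Lminus}) 𝔭)) :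
    Summit.BirchSwinnertonDyer.BirchSwinnertonDyer.Theses.ThetaPartnerAtTwo.SignedKatoDivisibilityUpToAtTwo :=
  signedKatoDivisibilityUpToAtTwo_of_contraFact_of_gzk_of_layerSide hK2 hGZK
    (layerSideTwoInv_of_ptOrth_of_noPT hS2 (NoPTOfCore.layerSideNoPTTwo_of_core hcore))

end Summit.BirchSwinnertonDyer.BirchSwinnertonDyer.Theorems.SignedKatoOffTwo.OfPubCore

end
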